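import Summits.MatrixMultiplication.OmegaCensus.SmallFormats.MatMulM22Length3m3Frames
import HarnessLib

/-!
# ω-census family (a): Alekseev's Lemma 12 mechanism at general frame parameters — rank-one X-forms among the frame members (any field), part 1

Cell `pub-omega` (unit `pub-omega-tensor`, gen 38), topic `Summits/MatrixMultiplication/OmegaCensus` (sub-folder
`SmallFormats`). Framing (verbatim): lottery ticket; floor = certified bounds/negative ranges. HONEST FRAMING: a structural lemma about
bilinear algorithms for `⟨m,2,2⟩` (equivalently `⟨2,2,m⟩`) over an ARBITRARY field, extracted from the proof of Alekseev 2015, Lemma 12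
(tree: `Alekseev2015.card_ge`, where it is run at parameters `(2m+1, m)` to produce ONE index with `D_t^1 = 0` after a column change). NEW
mathematics of the cell in this generality; NOT a bound on any rank by itself; nothing here is a bound on `ω`.

## The mechanism (dictionary of `Literature/…/MatMulM22RankLowerBoundProofs.lean`)

Frame `F` (independent first blocks `D_p^1 = f_p ⊗ p_p`, `p ∈ I`), a subfamily `I' ⊆ I` on which the `f_p` are linearly independent,
`c ∈ k^m`, `κc_p := ∑_i c_i κ_i^p` (so `Q_c := ∑ c_i P_i = ∑_{p ∈ I} κc_p D_p^1`), a vector `r ∈ k^m` with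
`∑_{p ∈ I} κc_p D_p^2 = ∑_j r_j P_j` («`R_c ∈ span P`»), `hh_p := ∑_j r_j κ_j^p`, and `κc`, `hh` vanishing on `I ∖ I'`. THEN
(`smul_qvec_eq_smul_pvec`) `κc_p q_p = hh_p p_p` for every `p ∈ I'`: every `p ∈ I'` with `κc_p ≠ 0` has a RANK-ONE X-form
`G_p = [p_p | q_p]` (`qvec_par_of_ne_zero`), and (`two_mul_finrank_le_card_rankOne`) for any subspace `C` of such `c` (each with its `r`),
`2 · dim C ≤ #{p ∈ I' : q_p ∥ p_p}` — the two columns of the `Q_c`, `c ∈ C`, are `2 · dim C` independent forms inside `span{f_p : p ∈ I', q_p ∥ p_p}`.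
Part 2 (to follow) bounds `dim C ≥ m − 2e − g` for a frame with `|I| = 2m + e`, `|J| = m + g`, so that a length-`(3m+δ)` algorithm has at
least `2(m − δ − e)` rank-one X-forms among the members of every frame (desk check `lemma12probe.py` on the cell's schemes: all identities
hold, the bound is attained).
-/

namespace Summit.MatrixMultiplication.OmegaCensus.SmallFormats

open Finset Module
open Literature.Computability.AlgebraicComplexity
open Literature.Computability.AlgebraicComplexity.Alekseev2015

namespace Lemma12Gen

variable {k : Type*} [Field k] {m : ℕ} {ι : Type*} [Fintype ι] [DecidableEq ι]
variable {β : BilinComp (mulBilin k m 2 2) ι} (F : Frame β)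

/-- `Q_c = ∑_i c_i P_i = ∑_{p ∈ I} κc_p D_p^1`. -/
theorem sum_rowMap_eq_sum_kc (c : Fin m → k) :
    ∑ i, c i • rowMap k m i = ∑ p ∈ F.I, (∑ i, c i * F.κ i p) • D1 β p := by
  simp only [Finset.sum_smul, mul_smul]
  rw [Finset.sum_comm]
  exact Finset.sum_congr rfl fun i _ => by rw [F.rowMap_eq_sum_κ i, Finset.smul_sum]

/-- A sum over `I` of terms vanishing off `I'` is the sum over `I'`. -/
private theorem sum_I_eq_sum_I' {I' : Finset ι} (hI'I : I' ⊆ F.I) (g : ι → Blk k m) (a : ι → k)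
    (ha : ∀ p ∈ F.I, p ∉ I' → a p = 0) : ∑ p ∈ F.I, a p • g p = ∑ p ∈ I', a p • g p := by
  rw [← Finset.sum_sdiff hI'I]
  have h0 : ∑ p ∈ F.I \ I', a p • g p = 0 :=
    Finset.sum_eq_zero fun p hp => by
      rw [ha p (Finset.mem_sdiff.1 hp).1 (Finset.mem_sdiff.1 hp).2, zero_smul]
  rw [h0, zero_add]

/-- **The mechanism** (Alekseev's Lemma 12 computation, general form): if `R_c = ∑_{p∈I} κc_p D_p^2 = ∑_j r_j P_j` and `κc`, `hh` vanish on
`I ∖ I'` where the `f_p`, `p ∈ I'`, are independent, then `κc_p q_p = hh_p p_p` for every `p ∈ I'`. -/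
theorem smul_qvec_eq_smul_pvec {I' : Finset ι} (hI'I : I' ⊆ F.I)
    (hI'indep : ∀ a : ι → k, ∑ p ∈ I', a p • β.f p = 0 → ∀ p ∈ I', a p = 0)
    (c r : Fin m → k) (hR : ∑ p ∈ F.I, (∑ i, c i * F.κ i p) • D2 β p = ∑ j, r j • rowMap k m j)
    (ha : ∀ p ∈ F.I, p ∉ I' → (∑ i, c i * F.κ i p) = 0) (hc : ∀ p ∈ F.I, p ∉ I' → (∑ j, r j * F.κ j p) = 0) :
    ∀ p ∈ I', (∑ i, c i * F.κ i p) • qvec β p = (∑ j, r j * F.κ j p) • pvec β p := by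
  -- ∑_{p ∈ I'} κc_p D²_p = ∑_j r_j P_j = ∑_{p ∈ I} hh_p D¹_p = ∑_{p ∈ I'} hh_p D¹_p
  have e2 : ∑ j, r j • rowMap k m j = ∑ p ∈ F.I, (∑ j, r j * F.κ j p) • D1 β p := by
    simp only [Finset.sum_smul, mul_smul]
    rw [Finset.sum_comm]
    exact Finset.sum_congr rfl fun j _ => by rw [F.rowMap_eq_sum_κ j, Finset.smul_sum]
  have hRI' : ∑ p ∈ I', (∑ i, c i * F.κ i p) • D2 β p = ∑ p ∈ I', (∑ j, r j * F.κ j p) • D1 β p := by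
    rw [← sum_I_eq_sum_I' F hI'I (D2 β) _ ha, hR, e2, sum_I_eq_sum_I' F hI'I (D1 β) _ hc]
  have hcol : ∀ c' : Fin 2, ∑ p ∈ I', ((∑ i, c i * F.κ i p) * qvec β p c' - (∑ j, r j * F.κ j p) * pvec β p c') • β.f p = 0 := by
    intro c'
    have := congrArg (col c') (sub_eq_zero.2 hRI')
    rw [map_zero, map_sub, map_sum, map_sum, ← Finset.sum_sub_distrib] at this
    rw [← this]
    refine Finset.sum_congr rfl fun p _ => ?_
    ext x
    simp only [LinearMap.smul_apply, LinearMap.sub_apply, map_smul, col_apply, D1_apply, D2_apply,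
      Pi.smul_apply, smul_eq_mul]
    ring
  intro p hp
  funext c'
  have := hI'indep _ (hcol c') p hp
  simp only [Pi.smul_apply, smul_eq_mul]
  exact sub_eq_zero.1 this

/-- **Rank-one X-forms**: under the same hypotheses, every `p ∈ I'` with `κc_p ≠ 0` has `q_p ∥ p_p`, i.e. the coefficient matrix
`G_p = [p_p | q_p]` of its form `g_p` on `y ∈ k^{2×2}` has rank one. -/
theorem qvec_par_of_ne_zero {I' : Finset ι} (hI'I : I' ⊆ F.I)
    (hI'indep : ∀ a : ι → k, ∑ p ∈ I', a p • β.f p = 0 → ∀ p ∈ I', a p = 0)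
    (c r : Fin m → k) (hR : ∑ p ∈ F.I, (∑ i, c i * F.κ i p) • D2 β p = ∑ j, r j • rowMap k m j)
    (ha : ∀ p ∈ F.I, p ∉ I' → (∑ i, c i * F.κ i p) = 0) (hc : ∀ p ∈ F.I, p ∉ I' → (∑ j, r j * F.κ j p) = 0)
    {p : ι} (hp : p ∈ I') (hne : (∑ i, c i * F.κ i p) ≠ 0) : ∃ a : k, qvec β p = a • pvec β p := by
  have h := smul_qvec_eq_smul_pvec F hI'I hI'indep c r hR ha hc p hp
  refine ⟨((∑ i, c i * F.κ i p))⁻¹ * (∑ j, r j * F.κ j p), ?_⟩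
  rw [mul_smul, ← h, smul_smul, inv_mul_cancel₀ hne, one_smul]

/-- The two columns of `Q_c = ∑ c_i P_i`: `col_{c'}(Q_c) = ∑_{p ∈ I} (κc_p p_p(c')) f_p`. -/
theorem col_sum_rowMap (c : Fin m → k) (c' : Fin 2) :
    col c' (∑ i, c i • rowMap k m i) = ∑ p ∈ F.I, ((∑ i, c i * F.κ i p) * pvec β p c') • β.f p := by
  rw [sum_rowMap_eq_sum_kc F c, map_sum]
  refine Finset.sum_congr rfl fun p _ => ?_
  rw [map_smul]
  have : col c' (D1 β p) = pvec β p c' • β.f p := by ext x; simp [mul_comm]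
  rw [this, smul_smul]

/-- The map `(c, c') ↦ col₀(Q_c) + col₁(Q_{c'})` is injective (the coordinate forms are independent). -/
theorem eq_zero_of_col_add_col_eq_zero (c c' : Fin m → k)
    (h : col 0 (∑ i, c i • rowMap k m i) + col 1 (∑ i, c' i • rowMap k m i) = 0) : c = 0 ∧ c' = 0 := by
  have hval : ∀ (d : Fin m → k) (cc i0 : _) (c0 : Fin 2),
      col cc (∑ i, d i • rowMap k m i) (Matrix.single i0 c0 (1 : k)) = if cc = c0 then d i0 else 0 := by
    intro d cc i0 c0
    simp only [col_apply, LinearMap.coe_sum, Finset.sum_apply, LinearMap.smul_apply, rowMap_apply, Pi.smul_apply,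
      smul_eq_mul, Matrix.single_apply]
    rw [Finset.sum_eq_single i0]
    · by_cases hc : cc = c0
      · simp [hc]
      · rw [if_neg (fun hh => hc hh.2.symm), if_neg hc, mul_zero]
    · intro i _ hi
      rw [if_neg (fun hh => hi hh.1.symm), mul_zero]
    · simp
  constructor
  · funext i0
    have := LinearMap.congr_fun h (Matrix.single i0 0 1)
    rw [LinearMap.add_apply, hval, hval, LinearMap.zero_apply] at this
    simpa using this
  · funext i0
    have := LinearMap.congr_fun h (Matrix.single i0 1 1)
    rw [LinearMap.add_apply, hval, hval, LinearMap.zero_apply] at this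
    simpa using this

open scoped Classical in
/-- **The count.** Let `C` be a subspace of `k^m` each of whose members `c` admits an `r` as in the mechanism (`R_c = ∑ r_j P_j`, `κc` and
`hh` vanishing on `I ∖ I'`). Then `2 · dim C ≤ #{p ∈ I' : q_p ∥ p_p}`: at least `2 · dim C` members of `I'` have rank-one X-forms. (For
`c ∈ C` the coefficient `κc_p` vanishes unless `q_p ∥ p_p`, so both columns of `Q_c` lie in the span of those `f_p`; and
`(c, c') ↦ col₀(Q_c) + col₁(Q_{c'})` is injective on `C × C`.) -/
theorem two_mul_finrank_le_card_rankOne {I' : Finset ι} (hI'I : I' ⊆ F.I)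
    (hI'indep : ∀ a : ι → k, ∑ p ∈ I', a p • β.f p = 0 → ∀ p ∈ I', a p = 0)
    (C : Submodule k (Fin m → k))
    (hC : ∀ c ∈ C, (∀ p ∈ F.I, p ∉ I' → (∑ i, c i * F.κ i p) = 0) ∧
      ∃ r : Fin m → k, ∑ p ∈ F.I, (∑ i, c i * F.κ i p) • D2 β p = ∑ j, r j • rowMap k m j ∧ ∀ p ∈ F.I, p ∉ I' → (∑ j, r j * F.κ j p) = 0) :
    2 * finrank k C ≤ (I'.filter fun p => ∃ a : k, qvec β p = a • pvec β p).card := by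
  classical
  set S := I'.filter fun p => ∃ a : k, qvec β p = a • pvec β p with hS
  -- κc vanishes off S for c ∈ C
  have hkc : ∀ c ∈ C, ∀ p ∈ F.I, p ∉ S → (∑ i, c i * F.κ i p) = 0 := by
    intro c hcC p hpI hpS
    obtain ⟨ha, r, hR, hc⟩ := hC c hcC
    by_cases hpI' : p ∈ I'
    · by_contra hne
      exact hpS (Finset.mem_filter.2 ⟨hpI', qvec_par_of_ne_zero F hI'I hI'indep c r hR ha hc hpI' hne⟩)
    · exact ha p hpI hpI'
  have hSI : S ⊆ F.I := fun p hp => hI'I (Finset.mem_filter.1 hp).1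
  -- the target span
  let T : Submodule k (Module.Dual k (Matrix (Fin m) (Fin 2) k)) := Submodule.span k (↑(S.image β.f) : Set _)
  have hcolmem : ∀ c ∈ C, ∀ c' : Fin 2, col c' (∑ i, c i • rowMap k m i) ∈ T := by
    intro c hcC c'
    rw [col_sum_rowMap F c c', ← Finset.sum_sdiff hSI]
    have h0 : ∑ p ∈ F.I \ S, ((∑ i, c i * F.κ i p) * pvec β p c') • β.f p = 0 :=
      Finset.sum_eq_zero fun p hp => by
        rw [hkc c hcC p (Finset.mem_sdiff.1 hp).1 (Finset.mem_sdiff.1 hp).2, zero_mul, zero_smul]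
    rw [h0, zero_add]
    refine Submodule.sum_mem _ fun p hp => Submodule.smul_mem _ _ (Submodule.subset_span ?_)
    rw [Finset.coe_image]
    exact ⟨p, hp, rfl⟩
  -- the injective map C × C → T
  have hsum_add : ∀ d d' : Fin m → k, ∑ i, (d + d') i • rowMap k m i = ∑ i, d i • rowMap k m i + ∑ i, d' i • rowMap k m i := by
    intro d d'
    rw [← Finset.sum_add_distrib]
    exact Finset.sum_congr rfl fun i _ => by rw [Pi.add_apply, add_smul]
  have hsum_smul : ∀ (a : k) (d : Fin m → k), ∑ i, (a • d) i • rowMap k m i = a • ∑ i, d i • rowMap k m i := by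
    intro a d
    rw [Finset.smul_sum]
    exact Finset.sum_congr rfl fun i _ => by rw [Pi.smul_apply, smul_eq_mul, mul_smul]
  let Ψ : (↥C × ↥C) →ₗ[k] Module.Dual k (Matrix (Fin m) (Fin 2) k) :=
    { toFun := fun cc => col 0 (∑ i, (cc.1 : Fin m → k) i • rowMap k m i) + col 1 (∑ i, (cc.2 : Fin m → k) i • rowMap k m i)
      map_add' := fun x y => by
        simp only [Prod.fst_add, Prod.snd_add, Submodule.coe_add, hsum_add, map_add]
        abel
      map_smul' := fun a x => by
        simp only [Prod.smul_fst, Prod.smul_snd, Submodule.coe_smul, hsum_smul, map_smul, RingHom.id_apply, smul_add] }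
  have hΨinj : Function.Injective Ψ := by
    rw [← LinearMap.ker_eq_bot, LinearMap.ker_eq_bot']
    intro cc hcc
    have hcc' : col 0 (∑ i, (cc.1 : Fin m → k) i • rowMap k m i) + col 1 (∑ i, (cc.2 : Fin m → k) i • rowMap k m i) = 0 := hcc
    obtain ⟨h1, h2⟩ := eq_zero_of_col_add_col_eq_zero (cc.1 : Fin m → k) (cc.2 : Fin m → k) hcc'
    have h1' : cc.1 = 0 := Subtype.ext h1
    have h2' : cc.2 = 0 := Subtype.ext h2
    exact Prod.ext h1' h2'
  have hΨrange : LinearMap.range Ψ ≤ T := by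
    rintro _ ⟨cc, rfl⟩
    exact Submodule.add_mem _ (hcolmem _ cc.1.2 0) (hcolmem _ cc.2.2 1)
  have h1 : finrank k (↥C × ↥C) = finrank k (LinearMap.range Ψ) := (LinearMap.finrank_range_of_inj hΨinj).symm
  have h2 := Submodule.finrank_mono hΨrange
  have h3 : finrank k T ≤ S.card :=
    (finrank_span_finset_le_card (R := k) (S.image β.f)).trans Finset.card_image_le
  rw [Module.finrank_prod] at h1
  omega

end Lemma12Gen

end Summit.MatrixMultiplication.OmegaCensus.SmallFormats
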